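import Literature.MathematicalPhysics.QuantumFieldTheory.Balaban1983to89.B13LocalisationRemainderLetters
import Literature.MathematicalPhysics.QuantumFieldTheory.Balaban1983to89.B9Thm311PosViaLocalFamilyY

/-!
# `Balaban1983to89.B13LocalisationRemainderRoad` — T. Bałaban, *Propagators for lattice gauge theories in a background field*, Commun. Math. Phys. **99** (1985)
# 389–434 [Balaban1985BackgroundPropagators], Thm 3.11 p. 416, (3.105)–(3.106) p. 414, (3.87)–(3.89) pp. 409–410, Thm 3.10 (3.107)–(3.108) pp. 415–416;
# [Balaban1984PropagatorsII] (2.44) p. 230, Lemma 2.1 (2.61) p. 234: THEOREM 3.11's LOCALISATION ROAD WITH THE REMAINDER's SMALLNESS DISCHARGED FROM LETTERS —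
# the sibling `B13LocalisationRemainderLetters` read in the torus letters ((3.108)-type decay ⟹ first moments and row sums by (2.61)), plugged into dag-n06-j's
# `posDefTr_of_localFamily_posDefTr_of_small`, and the row-17 face of the N06 certificate at node00-def-Y's letters: `PosDefTr 1 (Δ_a(U))` from local positivity
# `hloc` and ONE inequality between numbers `n·g·(2ωκ + ε) < 1` — print's «M sufficiently large».

statement-level bookkeeping ([folklore] `x ≤ e^x`, (2.61) row sums, compositions BY NAME) with citation tags; kernel-checked; THEOREMS ONLY (0 `def`, 0 instance,
0 notation); nothing here is a claim about the Yang–Mills mass gap; nothing of Bałaban's operators is asserted; no node is discharged; count-neutral.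

WHY THIS FILE (cell `pub-ymgap`, HUMAN RULING D-0062, Track A node N10 = [Balaban1988RG2Cluster] → N06 row 17; width seat `pub-ymgap-dag-n10-w6` g5; piece «L6» of the
N10 lane, second half).  See the sibling's header: dag-n06-j's road displays `hloc` and `hsmall`; the sibling turns `hsmall` into letters; this file (a) converts
(3.108)-type DECAY letters of `T` and of the local inverses into the sibling's first-moment ∕ row-sum numerals `κ = B·(2∕ρ)·m_F c₀(1,ρ∕2)^ν`, `g = B_G·m_F c₀(1,ρ_G)^ν`
([4] Lemma 2.1 on the one-scale torus, `B13LocalKernelWalks.rowSum_torus`), (b) assembles dag-n06-j's §2 with `hsmall` DISCHARGED, (c) states the row-17 face.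

WHAT THIS FILE PROVES (all `theorem`s).
§3 (torus letters; `loc : index → UT Nf`, fibres `≤ m_F`): `mul_exp_neg_mul_le` (`d·e^{−ρd} ≤ (2∕ρ)e^{−(ρ∕2)d}`), ★ `firstMoment_rowSum_le_of_decay` ∕ `firstMoment_colSum_le_of_decay`
   (`‖M_{ab}‖ ≤ B·e^{−ρd₁}` ⟹ `Σ_b ‖M_{ab}‖·d₁ ≤ B·(2∕ρ)·(m_F·c₀(1,ρ∕2)^ν)`), `rowSum_le_of_decay` ∕ `colSum_le_of_decay` (`≤ B·(m_F·c₀(1,ρ)^ν)`),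
   ★★ `trIP_localRemainder_le_of_decay` (the sibling's §2 in the letters `(B, ρ, B_G, ρ_G, m_F, n, ω, ε)`).
§4 (operators on `S → M_N(ℂ)`, flat pairing): ★★★ `posDefTr_of_localFamily_posDefTr_of_letters` (dag-n06-j's `posDefTr_of_localFamily_posDefTr_of_small` with `hsmall`
   supplied by the sibling: `IsSymmTr` + partition data + `hloc` + letters + `n·g·(2ωκ + ε) < 1` ⟹ `PosDefTr 1 T`), ★★ `posDefTr_of_local_posDefTr_of_letters` (`T_c := T`,
   no defect: `2·n·g·ω·κ < 1`), ★★★ `posDefTr_of_localFamily_posDefTr_of_decay` (the same in the torus letters of §3: ONE inequality between the numbers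
   `(B, ρ, B_G, ρ_G, m_F, n, ω, ε)`).
§5 (node00-def-Y's letters, `G ≤ U(N)`, `G`-valued `U`, carrier `FBondY i`): ★★★ `deltaAY_parSymY_posDefTr_of_localFamily_of_letters` (the ROW-17 FACE: the certificate's
   `PosDefTr 1 (deltaAY i (parSymY i) (parBY i) (GpY i (parSymY i)) U)` from `hloc` at any local family `Tloc` and the letter inequality), `GAY_parSymY_posDefTr_of_localFamily_of_letters`.

HONEST FRAMING: count-neutral Literature helper; `hloc` (Cor. 3.6's content — dag-n06-j's 5c∕5d deliver it on (3.35) per cube from the local-cube road's L5), the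
decay letters of `Δ_a(U)` and of the local inverses, the partition's slowness ∕ overlap and the defect sums stay DISPLAYED; which local family `Tloc` is «of record»
is node00-def-Y's ∕ dag-n06-j's word (LOCALISATION-MISMATCH clause inherited); finite-lattice constants, not print's `O(1)`; nothing of [Balaban1985BackgroundPropagators]
Thm 3.11 ∕ Cor. 3.6 ∕ Thms 3.1–3.2 asserted; N06 ∕ N10 NOT discharged; K1⁹ NOT closed, no registered stub proved; counts unmoved; one finite 𝕋⁴ programme at fixed ε —
R4 closes the conditional finite-𝕋⁴ rung `BalabanLadder.UV` only; nothing continuum ∕ ℝ⁴ ∕ OS ∕ mass gap ∕ Clay.  0 `sorry`, 0 `def`, standard axioms.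
`--supports stmt-QuantumFields-27364` (K1⁹).

References: [Balaban1985BackgroundPropagators] (3.27) p.395, (3.87)–(3.89) pp.409–410, (3.105)–(3.106) p.414, Thm 3.10 (3.107)–(3.108) pp.415–416, Thm 3.11 p.416;
[Balaban1984PropagatorsII] (2.44) p.230, (2.52) p.232, Lemma 2.1 (2.61) p.234, p.235; [Balaban1988RG2Cluster] p.15, (2.16) p.16.
-/

noncomputable section

namespace Literature.MathematicalPhysics.QuantumFieldTheory.Balaban1983to89.B13LocalisationRemainderRoad

open Finset
open scoped Matrix Matrix.Norms.L2Operator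
open Literature.MathematicalPhysics.QuantumFieldTheory.Balaban1983to89
open Literature.MathematicalPhysics.QuantumFieldTheory.Balaban1983to89.B9Thm37GlueTorus (tdist1 tdist1_nonneg)
open Literature.MathematicalPhysics.QuantumFieldTheory.Balaban1983to89.B5TorusCover (UT)
open Literature.MathematicalPhysics.QuantumFieldTheory.Balaban1983to89.B9Thm311ReadingCoords (trIP PosDefTr IsSymmTr)
open Literature.MathematicalPhysics.QuantumFieldTheory.Balaban1983to89.B9Thm37CubeCoverCommutators (cutMulY)
open Literature.MathematicalPhysics.QuantumFieldTheory.Balaban1983to89.B13LocalisationRemainderLetters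
  (trIP_localRemainder_le_of_letters abs_le_one_of_sum_sq_eq_one)
open Literature.MathematicalPhysics.QuantumFieldTheory.Balaban1983to89.B13AccretiveOfRealCoercive (rowSum_decay_le colSum_decay_le)
open Literature.MathematicalPhysics.QuantumFieldTheory.Balaban1983to89.B13LocalKernelWalks (rowSum_torus)
open Literature.MathematicalPhysics.QuantumFieldTheory.Balaban1983to89.B9Thm311PosViaLocalInversesY (deltaAY_parSymY_isSymmTr)
open Literature.MathematicalPhysics.QuantumFieldTheory.Balaban1983to89.B9Thm311PosViaLocalFamilyY (posDefTr_of_localFamily_posDefTr_of_small)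
open Literature.MathematicalPhysics.QuantumFieldTheory.Balaban1983to89.B9Thm311DeltaPrimePos (posDefTr_ringInverse)
open Literature.MathematicalPhysics.QuantumFieldTheory.Balaban1983to89.B6KLevelCensusIndexV1 (KIdx)
open Literature.MathematicalPhysics.QuantumFieldTheory.Balaban1983to89.Node00
open Literature.MathematicalPhysics.QuantumFieldTheory.Balaban1983to89.Node00.OpsYLocalInverse (dirPadY dirInvY)

/-! ## §3. Torus letters: the first-moment row sums from (3.108)-type decay, and the remainder bound in the letters -/

section Torus

variable {ν : ℕ} {Nf : Fin ν → ℕ} [∀ j, NeZero (Nf j)]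

/-- `d·e^{−ρd} ≤ (2∕ρ)·e^{−(ρ∕2)d}` for `ρ > 0` (`x ≤ e^x`). [folklore] [cite: Balaban1984PropagatorsII, Lemma 2.1 (2.61) p.234, bookkeeping] -/
theorem mul_exp_neg_mul_le {ρ : ℝ} (hρ : 0 < ρ) (d : ℝ) :
    d * Real.exp (-(ρ * d)) ≤ 2 / ρ * Real.exp (-(ρ / 2 * d)) := by
  have h1 : ρ / 2 * d ≤ Real.exp (ρ / 2 * d) := by
    have := Real.add_one_le_exp (ρ / 2 * d)
    linarith
  have h2 : d ≤ 2 / ρ * Real.exp (ρ / 2 * d) := by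
    rw [div_mul_eq_mul_div, le_div_iff₀ hρ]
    linarith
  calc d * Real.exp (-(ρ * d)) ≤ 2 / ρ * Real.exp (ρ / 2 * d) * Real.exp (-(ρ * d)) :=
        mul_le_mul_of_nonneg_right h2 (Real.exp_nonneg _)
    _ = 2 / ρ * Real.exp (-(ρ / 2 * d)) := by
        rw [mul_assoc, ← Real.exp_add]
        congr 2
        ring

variable {pI : Type} [Fintype pI]

/-- ★ **FIRST-MOMENT ROW SUMS FROM DECAY**: `‖M_{ab}‖ ≤ B·e^{−ρ d₁(loc a, loc b)}` (`B ≥ 0`, `ρ > 0`) and fibres `≤ m_F` ⟹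
`Σ_b ‖M_{ab}‖·d₁(loc a, loc b) ≤ B·(2∕ρ)·(m_F·c₀(1,ρ∕2)^ν)` (the torus row sum (2.61) at the half rate).
[cite: Balaban1984PropagatorsII, Lemma 2.1 (2.61) p.234; Balaban1985BackgroundPropagators, Thm 3.10 (3.108) p.416] -/
theorem firstMoment_rowSum_le_of_decay (M : Matrix pI pI ℂ) (loc : pI → UT Nf) {B ρ : ℝ} (hB : 0 ≤ B) (hρ : 0 < ρ)
    (hM : ∀ a b, ‖M a b‖ ≤ B * Real.exp (-(ρ * tdist1 Nf (loc a) (loc b)))) {mF : ℕ}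
    (hfib : ∀ y : UT Nf, (univ.filter fun k => loc k = y).card ≤ mF) (a : pI) :
    ∑ b, ‖M a b‖ * tdist1 Nf (loc a) (loc b) ≤ B * (2 / ρ) * (mF * B6.c0 1 (ρ / 2) ^ ν) := by
  calc ∑ b, ‖M a b‖ * tdist1 Nf (loc a) (loc b)
      ≤ ∑ b, B * (2 / ρ) * Real.exp (-(ρ / 2 * tdist1 Nf (loc a) (loc b))) := Finset.sum_le_sum fun b _ => by
        calc ‖M a b‖ * tdist1 Nf (loc a) (loc b) ≤ B * Real.exp (-(ρ * tdist1 Nf (loc a) (loc b))) * tdist1 Nf (loc a) (loc b) :=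
              mul_le_mul_of_nonneg_right (hM a b) (tdist1_nonneg _ _)
          _ = B * (tdist1 Nf (loc a) (loc b) * Real.exp (-(ρ * tdist1 Nf (loc a) (loc b)))) := by ring
          _ ≤ B * (2 / ρ * Real.exp (-(ρ / 2 * tdist1 Nf (loc a) (loc b)))) :=
              mul_le_mul_of_nonneg_left (mul_exp_neg_mul_le hρ _) hB
          _ = _ := by ring
    _ ≤ B * (2 / ρ) * (mF * B6.c0 1 (ρ / 2) ^ ν) :=
        rowSum_decay_le (by positivity) hfib (fun y => rowSum_torus Nf (half_pos hρ) y) a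

/-- … and the first-moment COLUMN sums (symmetry of `d₁`). [cite: Balaban1984PropagatorsII, (2.52) p.232, Lemma 2.1 (2.61) p.234] -/
theorem firstMoment_colSum_le_of_decay (M : Matrix pI pI ℂ) (loc : pI → UT Nf) {B ρ : ℝ} (hB : 0 ≤ B) (hρ : 0 < ρ)
    (hM : ∀ a b, ‖M a b‖ ≤ B * Real.exp (-(ρ * tdist1 Nf (loc a) (loc b)))) {mF : ℕ}
    (hfib : ∀ y : UT Nf, (univ.filter fun k => loc k = y).card ≤ mF) (b : pI) :
    ∑ a, ‖M a b‖ * tdist1 Nf (loc a) (loc b) ≤ B * (2 / ρ) * (mF * B6.c0 1 (ρ / 2) ^ ν) := by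
  calc ∑ a, ‖M a b‖ * tdist1 Nf (loc a) (loc b)
      ≤ ∑ a, B * (2 / ρ) * Real.exp (-(ρ / 2 * tdist1 Nf (loc a) (loc b))) := Finset.sum_le_sum fun a _ => by
        calc ‖M a b‖ * tdist1 Nf (loc a) (loc b) ≤ B * Real.exp (-(ρ * tdist1 Nf (loc a) (loc b))) * tdist1 Nf (loc a) (loc b) :=
              mul_le_mul_of_nonneg_right (hM a b) (tdist1_nonneg _ _)
          _ = B * (tdist1 Nf (loc a) (loc b) * Real.exp (-(ρ * tdist1 Nf (loc a) (loc b)))) := by ring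
          _ ≤ B * (2 / ρ * Real.exp (-(ρ / 2 * tdist1 Nf (loc a) (loc b)))) :=
              mul_le_mul_of_nonneg_left (mul_exp_neg_mul_le hρ _) hB
          _ = _ := by ring
    _ ≤ B * (2 / ρ) * (mF * B6.c0 1 (ρ / 2) ^ ν) :=
        colSum_decay_le (by positivity) hfib (fun y => rowSum_torus Nf (half_pos hρ) y) b

/-- plain row sums from decay: `Σ_b ‖M_{ab}‖ ≤ B·(m_F·c₀(1,ρ)^ν)`. [cite: Balaban1984PropagatorsII, Lemma 2.1 (2.61) p.234; Balaban1985BackgroundPropagators, (3.108) p.416] -/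
theorem rowSum_le_of_decay (M : Matrix pI pI ℂ) (loc : pI → UT Nf) {B ρ : ℝ} (hB : 0 ≤ B) (hρ : 0 < ρ)
    (hM : ∀ a b, ‖M a b‖ ≤ B * Real.exp (-(ρ * tdist1 Nf (loc a) (loc b)))) {mF : ℕ}
    (hfib : ∀ y : UT Nf, (univ.filter fun k => loc k = y).card ≤ mF) (a : pI) :
    ∑ b, ‖M a b‖ ≤ B * (mF * B6.c0 1 ρ ^ ν) :=
  (Finset.sum_le_sum fun b _ => hM a b).trans (rowSum_decay_le hB hfib (fun y => rowSum_torus Nf hρ y) a)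

/-- plain column sums from decay. [cite: Balaban1984PropagatorsII, (2.52) p.232, Lemma 2.1 (2.61) p.234] -/
theorem colSum_le_of_decay (M : Matrix pI pI ℂ) (loc : pI → UT Nf) {B ρ : ℝ} (hB : 0 ≤ B) (hρ : 0 < ρ)
    (hM : ∀ a b, ‖M a b‖ ≤ B * Real.exp (-(ρ * tdist1 Nf (loc a) (loc b)))) {mF : ℕ}
    (hfib : ∀ y : UT Nf, (univ.filter fun k => loc k = y).card ≤ mF) (b : pI) :
    ∑ a, ‖M a b‖ ≤ B * (mF * B6.c0 1 ρ ^ ν) :=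
  (Finset.sum_le_sum fun a _ => hM a b).trans (colSum_decay_le hB hfib (fun y => rowSum_torus Nf hρ y) b)

variable {S : Type} [Fintype S] [DecidableEq S] {N : ℕ} {ι : Type} [Fintype ι] [DecidableEq ι]

/-- ★★ **THE REMAINDER IS FORM-SMALL, IN THE TORUS LETTERS**: `T`'s product-basis matrix with (3.108)-type decay `(B, ρ)` at the locations `loc` (fibres `≤ m_F`),
the `G_c`'s with decay `(B_G, ρ_G)`, cut-offs slow at rate `ω` for `d₁ ∘ loc` with overlap `≤ n`, weighted defects `≤ ε` ⟹
`⟨A, R A⟩₁ ≤ n·(B_G·m_F c₀(1,ρ_G)^ν)·(2ω·(B·(2∕ρ)·m_F c₀(1,ρ∕2)^ν) + ε)·⟨A, A⟩₁`.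
[cite: Balaban1985BackgroundPropagators, Thm 3.11 proof p.416, (3.105) p.414, Thm 3.10 (3.107)–(3.108) pp.415–416, (3.89) p.409; Balaban1984PropagatorsII, Lemma 2.1 (2.61) p.234, p.235] -/
theorem trIP_localRemainder_le_of_decay (T : Module.End ℂ (S → Matrix (Fin N) (Fin N) ℂ))
    (Tloc Gop : ι → Module.End ℂ (S → Matrix (Fin N) (Fin N) ℂ)) (hf : ι → S → ℝ)
    (loc : S × (Fin N × Fin N) → UT Nf) {mF : ℕ} (hfib : ∀ y : UT Nf, (univ.filter fun k => loc k = y).card ≤ mF)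
    {B ρ BG ρG ω ε : ℝ} {n : ℕ} (hB : 0 ≤ B) (hρ : 0 < ρ) (hBG : 0 ≤ BG) (hρG : 0 < ρG) (hω : 0 ≤ ω) (hε : 0 ≤ ε)
    (hh1 : ∀ c x, |hf c x| ≤ 1) (hlip : ∀ c p s, |hf c p.1 - hf c s.1| ≤ ω * tdist1 Nf (loc p) (loc s))
    (hov : ∀ x : S, (univ.filter fun c => hf c x ≠ 0).card ≤ n)
    (hT : ∀ p s, ‖LinearMap.toMatrix ((Pi.basis fun _ : S => Matrix.stdBasis ℂ (Fin N) (Fin N)).reindex (Equiv.sigmaEquivProd (S) (Fin N × Fin N)))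
        ((Pi.basis fun _ : S => Matrix.stdBasis ℂ (Fin N) (Fin N)).reindex (Equiv.sigmaEquivProd (S) (Fin N × Fin N))) T p s‖ ≤ B * Real.exp (-(ρ * tdist1 Nf (loc p) (loc s))))
    (hG : ∀ c p s, ‖LinearMap.toMatrix ((Pi.basis fun _ : S => Matrix.stdBasis ℂ (Fin N) (Fin N)).reindex (Equiv.sigmaEquivProd (S) (Fin N × Fin N)))
        ((Pi.basis fun _ : S => Matrix.stdBasis ℂ (Fin N) (Fin N)).reindex (Equiv.sigmaEquivProd (S) (Fin N × Fin N))) (Gop c) p s‖ ≤ BG * Real.exp (-(ρG * tdist1 Nf (loc p) (loc s))))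
    (hErow : ∀ c p, |hf c p.1| * ∑ s, ‖LinearMap.toMatrix ((Pi.basis fun _ : S => Matrix.stdBasis ℂ (Fin N) (Fin N)).reindex (Equiv.sigmaEquivProd (S) (Fin N × Fin N)))
        ((Pi.basis fun _ : S => Matrix.stdBasis ℂ (Fin N) (Fin N)).reindex (Equiv.sigmaEquivProd (S) (Fin N × Fin N))) (Tloc c) p s
        - LinearMap.toMatrix ((Pi.basis fun _ : S => Matrix.stdBasis ℂ (Fin N) (Fin N)).reindex (Equiv.sigmaEquivProd (S) (Fin N × Fin N)))
        ((Pi.basis fun _ : S => Matrix.stdBasis ℂ (Fin N) (Fin N)).reindex (Equiv.sigmaEquivProd (S) (Fin N × Fin N))) T p s‖ ≤ ε)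
    (hEcol : ∀ c s, ∑ p, |hf c p.1| * ‖LinearMap.toMatrix ((Pi.basis fun _ : S => Matrix.stdBasis ℂ (Fin N) (Fin N)).reindex (Equiv.sigmaEquivProd (S) (Fin N × Fin N)))
        ((Pi.basis fun _ : S => Matrix.stdBasis ℂ (Fin N) (Fin N)).reindex (Equiv.sigmaEquivProd (S) (Fin N × Fin N))) (Tloc c) p s
        - LinearMap.toMatrix ((Pi.basis fun _ : S => Matrix.stdBasis ℂ (Fin N) (Fin N)).reindex (Equiv.sigmaEquivProd (S) (Fin N × Fin N)))
        ((Pi.basis fun _ : S => Matrix.stdBasis ℂ (Fin N) (Fin N)).reindex (Equiv.sigmaEquivProd (S) (Fin N × Fin N))) T p s‖ ≤ ε)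
    (A : S → Matrix (Fin N) (Fin N) ℂ) :
    trIP (fun _ => (1 : ℝ)) A ((∑ c, (cutMulY (hf c) * Tloc c - T * cutMulY (hf c)) * Gop c * cutMulY (hf c) :
        Module.End ℂ (S → Matrix (Fin N) (Fin N) ℂ)) A)
      ≤ n * (BG * (mF * B6.c0 1 ρG ^ ν)) * (2 * ω * (B * (2 / ρ) * (mF * B6.c0 1 (ρ / 2) ^ ν)) + ε) * trIP (fun _ => (1 : ℝ)) A A :=
  trIP_localRemainder_le_of_letters T Tloc Gop hf (fun p s => tdist1 Nf (loc p) (loc s)) hω (fun _ _ => tdist1_nonneg _ _)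
    (mul_nonneg hBG (mul_nonneg (Nat.cast_nonneg _) (pow_nonneg (B6RandomWalk.c0_nonneg 1 ρG) ν))) hε hh1 hlip hov
    (fun c s => rowSum_le_of_decay _ loc hBG hρG (hG c) hfib s) (fun c r => colSum_le_of_decay _ loc hBG hρG (hG c) hfib r)
    (fun p => firstMoment_rowSum_le_of_decay _ loc hB hρ hT hfib p) (fun s => firstMoment_colSum_le_of_decay _ loc hB hρ hT hfib s)
    hErow hEcol A

end Torus

/-! ## §4. Theorem 3.11's localisation road with `hsmall` DISCHARGED from the letters -/

section Assembly

variable {S : Type} [Fintype S] [DecidableEq S] {N : ℕ} {ι : Type} [Fintype ι] [DecidableEq ι]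
variable {ν : ℕ} {Nf : Fin ν → ℕ} [∀ j, NeZero (Nf j)]

/-- ★★★ **POSITIVE DEFINITENESS FROM LOCAL POSITIVITY AND THE REMAINDER's LETTERS** (n06-j's `posDefTr_of_localFamily_posDefTr_of_small` with its `hsmall` supplied by
§2): a trIP-symmetric `T` on `S → M_N(ℂ)` is positive definite (flat pairing) as soon as (i) every compression `M_{χ_c}T_cM_{χ_c} + 1 − M_{χ_c}` of the local operators is
positive definite and (ii) the LETTERS are small: `n·g·(2ωκ + ε) < 1`, where `g` bounds the row ∕ column sums of the local inverses `G_c = dirInvY (M_{χ_c}) T_c` in the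
product basis, `κ` the δ-first-moment row ∕ column sums of `T`, `ε` the `|h_c|`-weighted defect sums of `T_c − T`, `ω` the slowness of the partition `Σ_c h_c² = 1`
w.r.t. `δ`, `n` its overlap — print's «M sufficiently large» as ONE inequality between numbers.
[cite: Balaban1985BackgroundPropagators, Thm 3.11 p.416, (3.105)–(3.106) p.414, (3.87)–(3.89) p.409, p.410; Balaban1984PropagatorsII, Lemma 2.1 (2.61) p.234, p.235] -/
theorem posDefTr_of_localFamily_posDefTr_of_letters {T : Module.End ℂ (S → Matrix (Fin N) (Fin N) ℂ)} (hT : IsSymmTr (fun _ => (1 : ℝ)) T)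
    (Tloc : ι → Module.End ℂ (S → Matrix (Fin N) (Fin N) ℂ))
    (hf : ι → S → ℝ) (hsq : ∀ z, ∑ c, hf c z ^ 2 = 1) (χ : ι → S → ℝ) (hχ : ∀ c z, χ c z = 0 ∨ χ c z = 1)
    (hsupp : ∀ c z, hf c z ≠ 0 → χ c z = 1) (hloc : ∀ c, PosDefTr (fun _ => (1 : ℝ)) (dirPadY (cutMulY (χ c)) (Tloc c)))
    (δ : S × (Fin N × Fin N) → S × (Fin N × Fin N) → ℝ) {ω κ g ε : ℝ} {n : ℕ}
    (hω : 0 ≤ ω) (hδ : ∀ p s, 0 ≤ δ p s) (hg : 0 ≤ g) (hε : 0 ≤ ε)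
    (hlip : ∀ c p s, |hf c p.1 - hf c s.1| ≤ ω * δ p s) (hov : ∀ x : S, (univ.filter fun c => hf c x ≠ 0).card ≤ n)
    (hGrow : ∀ c s, ∑ r, ‖LinearMap.toMatrix ((Pi.basis fun _ : S => Matrix.stdBasis ℂ (Fin N) (Fin N)).reindex (Equiv.sigmaEquivProd (S) (Fin N × Fin N)))
        ((Pi.basis fun _ : S => Matrix.stdBasis ℂ (Fin N) (Fin N)).reindex (Equiv.sigmaEquivProd (S) (Fin N × Fin N))) (dirInvY (cutMulY (χ c)) (Tloc c)) s r‖ ≤ g)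
    (hGcol : ∀ c r, ∑ s, ‖LinearMap.toMatrix ((Pi.basis fun _ : S => Matrix.stdBasis ℂ (Fin N) (Fin N)).reindex (Equiv.sigmaEquivProd (S) (Fin N × Fin N)))
        ((Pi.basis fun _ : S => Matrix.stdBasis ℂ (Fin N) (Fin N)).reindex (Equiv.sigmaEquivProd (S) (Fin N × Fin N))) (dirInvY (cutMulY (χ c)) (Tloc c)) s r‖ ≤ g)
    (hTrow : ∀ p, ∑ s, ‖LinearMap.toMatrix ((Pi.basis fun _ : S => Matrix.stdBasis ℂ (Fin N) (Fin N)).reindex (Equiv.sigmaEquivProd (S) (Fin N × Fin N)))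
        ((Pi.basis fun _ : S => Matrix.stdBasis ℂ (Fin N) (Fin N)).reindex (Equiv.sigmaEquivProd (S) (Fin N × Fin N))) T p s‖ * δ p s ≤ κ)
    (hTcol : ∀ s, ∑ p, ‖LinearMap.toMatrix ((Pi.basis fun _ : S => Matrix.stdBasis ℂ (Fin N) (Fin N)).reindex (Equiv.sigmaEquivProd (S) (Fin N × Fin N)))
        ((Pi.basis fun _ : S => Matrix.stdBasis ℂ (Fin N) (Fin N)).reindex (Equiv.sigmaEquivProd (S) (Fin N × Fin N))) T p s‖ * δ p s ≤ κ)
    (hErow : ∀ c p, |hf c p.1| * ∑ s, ‖LinearMap.toMatrix ((Pi.basis fun _ : S => Matrix.stdBasis ℂ (Fin N) (Fin N)).reindex (Equiv.sigmaEquivProd (S) (Fin N × Fin N)))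
        ((Pi.basis fun _ : S => Matrix.stdBasis ℂ (Fin N) (Fin N)).reindex (Equiv.sigmaEquivProd (S) (Fin N × Fin N))) (Tloc c) p s
        - LinearMap.toMatrix ((Pi.basis fun _ : S => Matrix.stdBasis ℂ (Fin N) (Fin N)).reindex (Equiv.sigmaEquivProd (S) (Fin N × Fin N)))
        ((Pi.basis fun _ : S => Matrix.stdBasis ℂ (Fin N) (Fin N)).reindex (Equiv.sigmaEquivProd (S) (Fin N × Fin N))) T p s‖ ≤ ε)
    (hEcol : ∀ c s, ∑ p, |hf c p.1| * ‖LinearMap.toMatrix ((Pi.basis fun _ : S => Matrix.stdBasis ℂ (Fin N) (Fin N)).reindex (Equiv.sigmaEquivProd (S) (Fin N × Fin N)))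
        ((Pi.basis fun _ : S => Matrix.stdBasis ℂ (Fin N) (Fin N)).reindex (Equiv.sigmaEquivProd (S) (Fin N × Fin N))) (Tloc c) p s
        - LinearMap.toMatrix ((Pi.basis fun _ : S => Matrix.stdBasis ℂ (Fin N) (Fin N)).reindex (Equiv.sigmaEquivProd (S) (Fin N × Fin N)))
        ((Pi.basis fun _ : S => Matrix.stdBasis ℂ (Fin N) (Fin N)).reindex (Equiv.sigmaEquivProd (S) (Fin N × Fin N))) T p s‖ ≤ ε)
    (hθ : n * g * (2 * ω * κ + ε) < 1) :
    PosDefTr (fun _ => (1 : ℝ)) T :=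
  posDefTr_of_localFamily_posDefTr_of_small (fun _ => one_pos) hT Tloc hf hsq χ hχ hsupp hloc hθ
    (trIP_localRemainder_le_of_letters T Tloc (fun c => dirInvY (cutMulY (χ c)) (Tloc c)) hf δ hω hδ hg hε
      (abs_le_one_of_sum_sq_eq_one hf hsq) hlip hov hGrow hGcol hTrow hTcol hErow hEcol)

/-- ★★ the same with the local operators the compressions of `T` itself (`T_c := T`: no defect, `ε = 0`) — n06-j's first road `posDefTr_of_local_posDefTr_of_small`
with `hsmall` from the commutator letters alone: `2·n·g·ω·κ < 1`. [cite: Balaban1985BackgroundPropagators, Thm 3.11 p.416, (3.105) p.414, (3.88)–(3.89) p.409] -/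
theorem posDefTr_of_local_posDefTr_of_letters {T : Module.End ℂ (S → Matrix (Fin N) (Fin N) ℂ)} (hT : IsSymmTr (fun _ => (1 : ℝ)) T)
    (hf : ι → S → ℝ) (hsq : ∀ z, ∑ c, hf c z ^ 2 = 1) (χ : ι → S → ℝ) (hχ : ∀ c z, χ c z = 0 ∨ χ c z = 1)
    (hsupp : ∀ c z, hf c z ≠ 0 → χ c z = 1) (hloc : ∀ c, PosDefTr (fun _ => (1 : ℝ)) (dirPadY (cutMulY (χ c)) T))
    (δ : S × (Fin N × Fin N) → S × (Fin N × Fin N) → ℝ) {ω κ g : ℝ} {n : ℕ}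
    (hω : 0 ≤ ω) (hδ : ∀ p s, 0 ≤ δ p s) (hg : 0 ≤ g)
    (hlip : ∀ c p s, |hf c p.1 - hf c s.1| ≤ ω * δ p s) (hov : ∀ x : S, (univ.filter fun c => hf c x ≠ 0).card ≤ n)
    (hGrow : ∀ c s, ∑ r, ‖LinearMap.toMatrix ((Pi.basis fun _ : S => Matrix.stdBasis ℂ (Fin N) (Fin N)).reindex (Equiv.sigmaEquivProd (S) (Fin N × Fin N)))
        ((Pi.basis fun _ : S => Matrix.stdBasis ℂ (Fin N) (Fin N)).reindex (Equiv.sigmaEquivProd (S) (Fin N × Fin N))) (dirInvY (cutMulY (χ c)) T) s r‖ ≤ g)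
    (hGcol : ∀ c r, ∑ s, ‖LinearMap.toMatrix ((Pi.basis fun _ : S => Matrix.stdBasis ℂ (Fin N) (Fin N)).reindex (Equiv.sigmaEquivProd (S) (Fin N × Fin N)))
        ((Pi.basis fun _ : S => Matrix.stdBasis ℂ (Fin N) (Fin N)).reindex (Equiv.sigmaEquivProd (S) (Fin N × Fin N))) (dirInvY (cutMulY (χ c)) T) s r‖ ≤ g)
    (hTrow : ∀ p, ∑ s, ‖LinearMap.toMatrix ((Pi.basis fun _ : S => Matrix.stdBasis ℂ (Fin N) (Fin N)).reindex (Equiv.sigmaEquivProd (S) (Fin N × Fin N)))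
        ((Pi.basis fun _ : S => Matrix.stdBasis ℂ (Fin N) (Fin N)).reindex (Equiv.sigmaEquivProd (S) (Fin N × Fin N))) T p s‖ * δ p s ≤ κ)
    (hTcol : ∀ s, ∑ p, ‖LinearMap.toMatrix ((Pi.basis fun _ : S => Matrix.stdBasis ℂ (Fin N) (Fin N)).reindex (Equiv.sigmaEquivProd (S) (Fin N × Fin N)))
        ((Pi.basis fun _ : S => Matrix.stdBasis ℂ (Fin N) (Fin N)).reindex (Equiv.sigmaEquivProd (S) (Fin N × Fin N))) T p s‖ * δ p s ≤ κ)
    (hθ : 2 * n * g * ω * κ < 1) :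
    PosDefTr (fun _ => (1 : ℝ)) T := by
  refine posDefTr_of_localFamily_posDefTr_of_letters hT (fun _ => T) hf hsq χ hχ hsupp hloc δ hω hδ hg le_rfl hlip hov hGrow hGcol hTrow hTcol
    (fun c p => ?_) (fun c s => ?_) (by nlinarith)
  · simp
  · simp

/-- ★★★ the same road IN THE TORUS LETTERS (§3): decay `(B, ρ)` of `T`'s product-basis matrix and `(B_G, ρ_G)` of the local inverses' at the locations `loc`
(fibres `≤ m_F`), slowness `ω` of the partition for `d₁ ∘ loc`, overlap `n`, weighted defect sums `ε`, and the ONE inequality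
`n·(B_G·m_F c₀(1,ρ_G)^ν)·(2ω·(B·(2∕ρ)·m_F c₀(1,ρ∕2)^ν) + ε) < 1` ⟹ `PosDefTr 1 T`.
[cite: Balaban1985BackgroundPropagators, Thm 3.11 p.416, (3.105)–(3.106) p.414, Thm 3.10 (3.107)–(3.108) pp.415–416, (3.89) p.409; Balaban1984PropagatorsII, Lemma 2.1 (2.61) p.234, p.235] -/
theorem posDefTr_of_localFamily_posDefTr_of_decay {T : Module.End ℂ (S → Matrix (Fin N) (Fin N) ℂ)} (hT : IsSymmTr (fun _ => (1 : ℝ)) T)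
    (Tloc : ι → Module.End ℂ (S → Matrix (Fin N) (Fin N) ℂ))
    (hf : ι → S → ℝ) (hsq : ∀ z, ∑ c, hf c z ^ 2 = 1) (χ : ι → S → ℝ) (hχ : ∀ c z, χ c z = 0 ∨ χ c z = 1)
    (hsupp : ∀ c z, hf c z ≠ 0 → χ c z = 1) (hloc : ∀ c, PosDefTr (fun _ => (1 : ℝ)) (dirPadY (cutMulY (χ c)) (Tloc c)))
    (loc : S × (Fin N × Fin N) → UT Nf) {mF : ℕ} (hfib : ∀ y : UT Nf, (univ.filter fun k => loc k = y).card ≤ mF)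
    {B ρ BG ρG ω ε : ℝ} {n : ℕ} (hB : 0 ≤ B) (hρ : 0 < ρ) (hBG : 0 ≤ BG) (hρG : 0 < ρG) (hω : 0 ≤ ω) (hε : 0 ≤ ε)
    (hlip : ∀ c p s, |hf c p.1 - hf c s.1| ≤ ω * tdist1 Nf (loc p) (loc s))
    (hov : ∀ x : S, (univ.filter fun c => hf c x ≠ 0).card ≤ n)
    (hTd : ∀ p s, ‖LinearMap.toMatrix ((Pi.basis fun _ : S => Matrix.stdBasis ℂ (Fin N) (Fin N)).reindex (Equiv.sigmaEquivProd (S) (Fin N × Fin N)))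
        ((Pi.basis fun _ : S => Matrix.stdBasis ℂ (Fin N) (Fin N)).reindex (Equiv.sigmaEquivProd (S) (Fin N × Fin N))) T p s‖ ≤ B * Real.exp (-(ρ * tdist1 Nf (loc p) (loc s))))
    (hGd : ∀ c p s, ‖LinearMap.toMatrix ((Pi.basis fun _ : S => Matrix.stdBasis ℂ (Fin N) (Fin N)).reindex (Equiv.sigmaEquivProd (S) (Fin N × Fin N)))
        ((Pi.basis fun _ : S => Matrix.stdBasis ℂ (Fin N) (Fin N)).reindex (Equiv.sigmaEquivProd (S) (Fin N × Fin N))) (dirInvY (cutMulY (χ c)) (Tloc c)) p s‖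
        ≤ BG * Real.exp (-(ρG * tdist1 Nf (loc p) (loc s))))
    (hErow : ∀ c p, |hf c p.1| * ∑ s, ‖LinearMap.toMatrix ((Pi.basis fun _ : S => Matrix.stdBasis ℂ (Fin N) (Fin N)).reindex (Equiv.sigmaEquivProd (S) (Fin N × Fin N)))
        ((Pi.basis fun _ : S => Matrix.stdBasis ℂ (Fin N) (Fin N)).reindex (Equiv.sigmaEquivProd (S) (Fin N × Fin N))) (Tloc c) p s
        - LinearMap.toMatrix ((Pi.basis fun _ : S => Matrix.stdBasis ℂ (Fin N) (Fin N)).reindex (Equiv.sigmaEquivProd (S) (Fin N × Fin N)))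
        ((Pi.basis fun _ : S => Matrix.stdBasis ℂ (Fin N) (Fin N)).reindex (Equiv.sigmaEquivProd (S) (Fin N × Fin N))) T p s‖ ≤ ε)
    (hEcol : ∀ c s, ∑ p, |hf c p.1| * ‖LinearMap.toMatrix ((Pi.basis fun _ : S => Matrix.stdBasis ℂ (Fin N) (Fin N)).reindex (Equiv.sigmaEquivProd (S) (Fin N × Fin N)))
        ((Pi.basis fun _ : S => Matrix.stdBasis ℂ (Fin N) (Fin N)).reindex (Equiv.sigmaEquivProd (S) (Fin N × Fin N))) (Tloc c) p s
        - LinearMap.toMatrix ((Pi.basis fun _ : S => Matrix.stdBasis ℂ (Fin N) (Fin N)).reindex (Equiv.sigmaEquivProd (S) (Fin N × Fin N)))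
        ((Pi.basis fun _ : S => Matrix.stdBasis ℂ (Fin N) (Fin N)).reindex (Equiv.sigmaEquivProd (S) (Fin N × Fin N))) T p s‖ ≤ ε)
    (hθ : n * (BG * (mF * B6.c0 1 ρG ^ ν)) * (2 * ω * (B * (2 / ρ) * (mF * B6.c0 1 (ρ / 2) ^ ν)) + ε) < 1) :
    PosDefTr (fun _ => (1 : ℝ)) T :=
  posDefTr_of_localFamily_posDefTr_of_small (fun _ => one_pos) hT Tloc hf hsq χ hχ hsupp hloc hθ
    (trIP_localRemainder_le_of_decay T Tloc (fun c => dirInvY (cutMulY (χ c)) (Tloc c)) hf loc hfib hB hρ hBG hρG hω hε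
      (abs_le_one_of_sum_sq_eq_one hf hsq) hlip hov hTd hGd hErow hEcol)

end Assembly

/-! ## §5. The row-17 face at def-Y's letters: `hΔA(U)` from local positivity and the remainder's LETTERS -/

section Row17

variable {d ℓ : ℕ} {hd : 1 ≤ d + 1} {hL : Odd (ℓ + 1) ∧ 1 < ℓ + 1} {b₀ b₁ : ℝ} {N : ℕ}
variable (i : KIdx d ℓ hd hL b₀ b₁) {G : Subgroup (Matrix (Fin N) (Fin N) ℂ)ˣ} {ι : Type} [Fintype ι] [DecidableEq ι]

/-- ★★★ **ROW 17 BY PRINT's ROAD WITH THE REMAINDER's LETTERS** (n06-j's `deltaAY_parSymY_posDefTr_of_localFamily`, `hsmall` DISCHARGED by §2): for `G ≤ U(N)`, a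
`G`-valued `U` and ANY family `Tloc` of local operators on the bond functions, the certificate's `PosDefTr 1 (Δ_a(U))` follows from (i) positivity of every
compressed `Tloc c` and (ii) the LETTER inequality `n·g·(2ωκ + ε) < 1` — `g` the product-basis row ∕ column sums of the local inverses, `κ` the δ-first moments
of `Δ_a(U)`'s product-basis matrix, `ε` the weighted defect sums of `Tloc c − Δ_a(U)`, `(ω, n)` the partition's slowness and overlap.
[cite: Balaban1985BackgroundPropagators, Thm 3.11 p.416, (3.105)–(3.106) p.414, (3.87)–(3.89) p.409, p.410; Balaban1984PropagatorsII, Lemma 2.1 (2.61) p.234] -/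
theorem deltaAY_parSymY_posDefTr_of_localFamily_of_letters (hG : G ≤ B7Prop2Explicit.unitaryUnits (Matrix (Fin N) (Fin N) ℂ))
    {U : CfgY (Matrix (Fin N) (Fin N) ℂ) i} (hU : ∀ μ x, U μ x ∈ G)
    (Tloc : ι → Module.End ℂ (FBondY i → Matrix (Fin N) (Fin N) ℂ))
    (hf : ι → FBondY i → ℝ) (hsq : ∀ b, ∑ c, hf c b ^ 2 = 1) (χ : ι → FBondY i → ℝ) (hχ : ∀ c b, χ c b = 0 ∨ χ c b = 1)
    (hsupp : ∀ c b, hf c b ≠ 0 → χ c b = 1)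
    (hloc : ∀ c, PosDefTr (fun _ => (1 : ℝ)) (dirPadY (cutMulY (χ c)) (Tloc c)))
    (δ : FBondY i × (Fin N × Fin N) → FBondY i × (Fin N × Fin N) → ℝ) {ω κ g ε : ℝ} {n : ℕ}
    (hω : 0 ≤ ω) (hδ : ∀ p s, 0 ≤ δ p s) (hg : 0 ≤ g) (hε : 0 ≤ ε)
    (hlip : ∀ c p s, |hf c p.1 - hf c s.1| ≤ ω * δ p s) (hov : ∀ b : FBondY i, (univ.filter fun c => hf c b ≠ 0).card ≤ n)
    (hGrow : ∀ c s, ∑ r, ‖LinearMap.toMatrix ((Pi.basis fun _ : FBondY i => Matrix.stdBasis ℂ (Fin N) (Fin N)).reindex (Equiv.sigmaEquivProd (FBondY i) (Fin N × Fin N)))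
        ((Pi.basis fun _ : FBondY i => Matrix.stdBasis ℂ (Fin N) (Fin N)).reindex (Equiv.sigmaEquivProd (FBondY i) (Fin N × Fin N))) (dirInvY (cutMulY (χ c)) (Tloc c)) s r‖ ≤ g)
    (hGcol : ∀ c r, ∑ s, ‖LinearMap.toMatrix ((Pi.basis fun _ : FBondY i => Matrix.stdBasis ℂ (Fin N) (Fin N)).reindex (Equiv.sigmaEquivProd (FBondY i) (Fin N × Fin N)))
        ((Pi.basis fun _ : FBondY i => Matrix.stdBasis ℂ (Fin N) (Fin N)).reindex (Equiv.sigmaEquivProd (FBondY i) (Fin N × Fin N))) (dirInvY (cutMulY (χ c)) (Tloc c)) s r‖ ≤ g)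
    (hTrow : ∀ p, ∑ s, ‖LinearMap.toMatrix ((Pi.basis fun _ : FBondY i => Matrix.stdBasis ℂ (Fin N) (Fin N)).reindex (Equiv.sigmaEquivProd (FBondY i) (Fin N × Fin N)))
        ((Pi.basis fun _ : FBondY i => Matrix.stdBasis ℂ (Fin N) (Fin N)).reindex (Equiv.sigmaEquivProd (FBondY i) (Fin N × Fin N))) (deltaAY i (parSymY i) (parBY i) (GpY i (parSymY i)) U) p s‖ * δ p s ≤ κ)
    (hTcol : ∀ s, ∑ p, ‖LinearMap.toMatrix ((Pi.basis fun _ : FBondY i => Matrix.stdBasis ℂ (Fin N) (Fin N)).reindex (Equiv.sigmaEquivProd (FBondY i) (Fin N × Fin N)))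
        ((Pi.basis fun _ : FBondY i => Matrix.stdBasis ℂ (Fin N) (Fin N)).reindex (Equiv.sigmaEquivProd (FBondY i) (Fin N × Fin N))) (deltaAY i (parSymY i) (parBY i) (GpY i (parSymY i)) U) p s‖ * δ p s ≤ κ)
    (hErow : ∀ c p, |hf c p.1| * ∑ s, ‖LinearMap.toMatrix ((Pi.basis fun _ : FBondY i => Matrix.stdBasis ℂ (Fin N) (Fin N)).reindex (Equiv.sigmaEquivProd (FBondY i) (Fin N × Fin N)))
        ((Pi.basis fun _ : FBondY i => Matrix.stdBasis ℂ (Fin N) (Fin N)).reindex (Equiv.sigmaEquivProd (FBondY i) (Fin N × Fin N))) (Tloc c) p s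
        - LinearMap.toMatrix ((Pi.basis fun _ : FBondY i => Matrix.stdBasis ℂ (Fin N) (Fin N)).reindex (Equiv.sigmaEquivProd (FBondY i) (Fin N × Fin N)))
        ((Pi.basis fun _ : FBondY i => Matrix.stdBasis ℂ (Fin N) (Fin N)).reindex (Equiv.sigmaEquivProd (FBondY i) (Fin N × Fin N))) (deltaAY i (parSymY i) (parBY i) (GpY i (parSymY i)) U) p s‖ ≤ ε)
    (hEcol : ∀ c s, ∑ p, |hf c p.1| * ‖LinearMap.toMatrix ((Pi.basis fun _ : FBondY i => Matrix.stdBasis ℂ (Fin N) (Fin N)).reindex (Equiv.sigmaEquivProd (FBondY i) (Fin N × Fin N)))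
        ((Pi.basis fun _ : FBondY i => Matrix.stdBasis ℂ (Fin N) (Fin N)).reindex (Equiv.sigmaEquivProd (FBondY i) (Fin N × Fin N))) (Tloc c) p s
        - LinearMap.toMatrix ((Pi.basis fun _ : FBondY i => Matrix.stdBasis ℂ (Fin N) (Fin N)).reindex (Equiv.sigmaEquivProd (FBondY i) (Fin N × Fin N)))
        ((Pi.basis fun _ : FBondY i => Matrix.stdBasis ℂ (Fin N) (Fin N)).reindex (Equiv.sigmaEquivProd (FBondY i) (Fin N × Fin N))) (deltaAY i (parSymY i) (parBY i) (GpY i (parSymY i)) U) p s‖ ≤ ε)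
    (hθ : n * g * (2 * ω * κ + ε) < 1) :
    PosDefTr (fun _ => (1 : ℝ)) (deltaAY i (parSymY i) (parBY i) (GpY i (parSymY i)) U) :=
  posDefTr_of_localFamily_posDefTr_of_letters (deltaAY_parSymY_isSymmTr i hG hU) Tloc hf hsq χ hχ hsupp hloc δ hω hδ hg hε hlip hov
    hGrow hGcol hTrow hTcol hErow hEcol hθ

/-- … hence `G(U) = Δ_a(U)⁻¹` (def-Y's `GAY`) is positive definite on the same inputs. [cite: Balaban1985BackgroundPropagators, Thm 3.11 p.416 («it is enough to prove it for G»), (3.27) p.395] -/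
theorem GAY_parSymY_posDefTr_of_localFamily_of_letters (hG : G ≤ B7Prop2Explicit.unitaryUnits (Matrix (Fin N) (Fin N) ℂ))
    {U : CfgY (Matrix (Fin N) (Fin N) ℂ) i} (hU : ∀ μ x, U μ x ∈ G)
    (Tloc : ι → Module.End ℂ (FBondY i → Matrix (Fin N) (Fin N) ℂ))
    (hf : ι → FBondY i → ℝ) (hsq : ∀ b, ∑ c, hf c b ^ 2 = 1) (χ : ι → FBondY i → ℝ) (hχ : ∀ c b, χ c b = 0 ∨ χ c b = 1)
    (hsupp : ∀ c b, hf c b ≠ 0 → χ c b = 1)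
    (hloc : ∀ c, PosDefTr (fun _ => (1 : ℝ)) (dirPadY (cutMulY (χ c)) (Tloc c)))
    (δ : FBondY i × (Fin N × Fin N) → FBondY i × (Fin N × Fin N) → ℝ) {ω κ g ε : ℝ} {n : ℕ}
    (hω : 0 ≤ ω) (hδ : ∀ p s, 0 ≤ δ p s) (hg : 0 ≤ g) (hε : 0 ≤ ε)
    (hlip : ∀ c p s, |hf c p.1 - hf c s.1| ≤ ω * δ p s) (hov : ∀ b : FBondY i, (univ.filter fun c => hf c b ≠ 0).card ≤ n)
    (hGrow : ∀ c s, ∑ r, ‖LinearMap.toMatrix ((Pi.basis fun _ : FBondY i => Matrix.stdBasis ℂ (Fin N) (Fin N)).reindex (Equiv.sigmaEquivProd (FBondY i) (Fin N × Fin N)))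
        ((Pi.basis fun _ : FBondY i => Matrix.stdBasis ℂ (Fin N) (Fin N)).reindex (Equiv.sigmaEquivProd (FBondY i) (Fin N × Fin N))) (dirInvY (cutMulY (χ c)) (Tloc c)) s r‖ ≤ g)
    (hGcol : ∀ c r, ∑ s, ‖LinearMap.toMatrix ((Pi.basis fun _ : FBondY i => Matrix.stdBasis ℂ (Fin N) (Fin N)).reindex (Equiv.sigmaEquivProd (FBondY i) (Fin N × Fin N)))
        ((Pi.basis fun _ : FBondY i => Matrix.stdBasis ℂ (Fin N) (Fin N)).reindex (Equiv.sigmaEquivProd (FBondY i) (Fin N × Fin N))) (dirInvY (cutMulY (χ c)) (Tloc c)) s r‖ ≤ g)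
    (hTrow : ∀ p, ∑ s, ‖LinearMap.toMatrix ((Pi.basis fun _ : FBondY i => Matrix.stdBasis ℂ (Fin N) (Fin N)).reindex (Equiv.sigmaEquivProd (FBondY i) (Fin N × Fin N)))
        ((Pi.basis fun _ : FBondY i => Matrix.stdBasis ℂ (Fin N) (Fin N)).reindex (Equiv.sigmaEquivProd (FBondY i) (Fin N × Fin N))) (deltaAY i (parSymY i) (parBY i) (GpY i (parSymY i)) U) p s‖ * δ p s ≤ κ)
    (hTcol : ∀ s, ∑ p, ‖LinearMap.toMatrix ((Pi.basis fun _ : FBondY i => Matrix.stdBasis ℂ (Fin N) (Fin N)).reindex (Equiv.sigmaEquivProd (FBondY i) (Fin N × Fin N)))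
        ((Pi.basis fun _ : FBondY i => Matrix.stdBasis ℂ (Fin N) (Fin N)).reindex (Equiv.sigmaEquivProd (FBondY i) (Fin N × Fin N))) (deltaAY i (parSymY i) (parBY i) (GpY i (parSymY i)) U) p s‖ * δ p s ≤ κ)
    (hErow : ∀ c p, |hf c p.1| * ∑ s, ‖LinearMap.toMatrix ((Pi.basis fun _ : FBondY i => Matrix.stdBasis ℂ (Fin N) (Fin N)).reindex (Equiv.sigmaEquivProd (FBondY i) (Fin N × Fin N)))
        ((Pi.basis fun _ : FBondY i => Matrix.stdBasis ℂ (Fin N) (Fin N)).reindex (Equiv.sigmaEquivProd (FBondY i) (Fin N × Fin N))) (Tloc c) p s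
        - LinearMap.toMatrix ((Pi.basis fun _ : FBondY i => Matrix.stdBasis ℂ (Fin N) (Fin N)).reindex (Equiv.sigmaEquivProd (FBondY i) (Fin N × Fin N)))
        ((Pi.basis fun _ : FBondY i => Matrix.stdBasis ℂ (Fin N) (Fin N)).reindex (Equiv.sigmaEquivProd (FBondY i) (Fin N × Fin N))) (deltaAY i (parSymY i) (parBY i) (GpY i (parSymY i)) U) p s‖ ≤ ε)
    (hEcol : ∀ c s, ∑ p, |hf c p.1| * ‖LinearMap.toMatrix ((Pi.basis fun _ : FBondY i => Matrix.stdBasis ℂ (Fin N) (Fin N)).reindex (Equiv.sigmaEquivProd (FBondY i) (Fin N × Fin N)))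
        ((Pi.basis fun _ : FBondY i => Matrix.stdBasis ℂ (Fin N) (Fin N)).reindex (Equiv.sigmaEquivProd (FBondY i) (Fin N × Fin N))) (Tloc c) p s
        - LinearMap.toMatrix ((Pi.basis fun _ : FBondY i => Matrix.stdBasis ℂ (Fin N) (Fin N)).reindex (Equiv.sigmaEquivProd (FBondY i) (Fin N × Fin N)))
        ((Pi.basis fun _ : FBondY i => Matrix.stdBasis ℂ (Fin N) (Fin N)).reindex (Equiv.sigmaEquivProd (FBondY i) (Fin N × Fin N))) (deltaAY i (parSymY i) (parBY i) (GpY i (parSymY i)) U) p s‖ ≤ ε)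
    (hθ : n * g * (2 * ω * κ + ε) < 1) :
    PosDefTr (fun _ => (1 : ℝ)) (GAY i (parSymY i) (parBY i) (GpY i (parSymY i)) U) :=
  posDefTr_ringInverse (deltaAY_parSymY_posDefTr_of_localFamily_of_letters i hG hU Tloc hf hsq χ hχ hsupp hloc δ hω hδ hg hε hlip hov
    hGrow hGcol hTrow hTcol hErow hEcol hθ)

end Row17

end Literature.MathematicalPhysics.QuantumFieldTheory.Balaban1983to89.B13LocalisationRemainderRoad

end
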